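import Literature.NumberTheory.LFunctions.SoundararajanContourEventually
import Literature.NumberTheory.LFunctions.MoebiusTwistPerron
import Literature.NumberTheory.LFunctions.InvZetaSmallOrdinatesRH
import Literature.NumberTheory.LFunctions.NymanBeurlingRateInvZetaApprox
import HarnessLib

/-!
# `M(x) ≪ √x exp((log x)^{1/2}(log log x)^{5/2+δ})` under RH, from the engine of Soundararajan's method

Topic `Literature/NumberTheory/LFunctions`; a brick of the reduction of
`Literature.NumberTheory.LFunctions.BalazardDeRoton2010_thm1` to the engine statements of
Soundararajan's method. K. Soundararajan, *Partial sums of the Möbius function*, J. reine angew.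
Math. 631 (2009), Theorem 1, in the refined form of M. Balazard, A. de Roton, arXiv:0810.3587,
Théorème 1 ("`M(x) ≪ √x exp((log x)^{1/2}(log log x)^{5/2+ε})`"):

§8.5: "En réunissant les résultats des propositions 21, 22 et 24, on obtient
`N^{-1/2}M(N) ≪_δ exp((log N)^{1/2}(log log N)^{c+δ}) + exp((log N)^{1/2}(log log N)^{5−c+6δ})`.
On choisit alors `c = 5/2` et `δ` arbitrairement petit pour démontrer le théorème."

Here the deep inputs of that proof — the conclusions of their Propositions 1, 18 and 20 (Soundararajan's
method proper: lower bounds for `log|ζ|` near typical ordinates, all ordinates typical for large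
`V`, rarity of well-spaced atypical ordinates) — are HYPOTHESES, in the packaged forms
`TypicalPointwise.Prop1With`, `TypicalLadder.Prop18With`, `TypicalCounting.Prop20With`; everything
else (Perron, the contour, Props. 9, 19, 21–24) is proved in the tree
(`PerronTruncatedBounded`, `MoebiusTwistPerron`, `SoundararajanContour*`, `TypicalOrdinate*`).
The output `SoundContour.mertens_bound_of_engine` is exactly hypothesis `hA` of
`Literature.NumberTheory.LFunctions.BalazardDeRoton2010_thm1_of_deep`.

## References

* K. Soundararajan, Partial sums of the Möbius function, J. reine angew. Math. 631 (2009), Thm. 1.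
* [BalazardRoton2008] M. Balazard, A. de Roton, arXiv:0810.3587, Théorème 1 and §8.5.
* [BalazardDeRoton2010] M. Balazard, A. de Roton, arXiv:0812.1689, §6.1 (the input (A)).
-/

noncomputable section

open Complex Real Filter Finset

namespace Literature.NumberTheory.LFunctions

namespace SoundContour

open Soundararajan TypicalLadder TypicalPointwise TypicalCounting TypicalLevelSets
open BalazardDeRoton BaezDuarteOnlyIf MoebiusTwistPerron

/-! ### Normalizing the engine constants -/

/-- Proposition 1 with `D` replaced by `max D 0`. [folklore] -/
lemma Prop1With.mono_max {δ D T₀ : ℝ} (hδ : 0 < δ) (h : Prop1With δ D T₀) : Prop1With δ (max D 0) T₀ := by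
  intro T hT V hV1 hV2 t ht σ
  obtain ⟨h1, h2⟩ := h T hT V hV1 hV2 t ht σ
  have hV0 : 0 ≤ V := le_trans (sq_nonneg _) hV1
  have hDm : D ≤ max D 0 := le_max_left _ _
  refine ⟨fun ha hb ↦ ?_, fun ha hb ↦ ?_⟩
  · have := h1 ha hb
    have : D * V * δ⁻¹ ^ 2 ≤ max D 0 * V * δ⁻¹ ^ 2 :=
      mul_le_mul_of_nonneg_right (mul_le_mul_of_nonneg_right hDm hV0) (sq_nonneg _)
    linarith
  · have := h2 ha hb
    have : D * V * δ⁻¹ ≤ max D 0 * V * δ⁻¹ :=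
      mul_le_mul_of_nonneg_right (mul_le_mul_of_nonneg_right hDm hV0) (inv_nonneg.2 hδ.le)
    linarith

/-- Proposition 20 with `C` replaced by `max C 0` (and `T₀` by `max T₀ 0`). [folklore] -/
lemma Prop20With.mono_max {δ C D T₀ : ℝ} (h : Prop20With δ C D T₀) :
    Prop20With δ (max C 0) D (max T₀ 0) := by
  intro T hT V hV1 hV2 S hS hsp
  have hT0 : 0 ≤ T := le_trans (le_max_right _ _) hT
  have := h T (le_trans (le_max_left _ _) hT) V hV1 hV2 S hS hsp
  refine this.trans ?_
  exact mul_le_mul_of_nonneg_right (mul_le_mul_of_nonneg_right (le_max_left _ _) hT0)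
    (Real.exp_pos _).le

/-! ### `M(N)` as `moebiusSum N 0` -/

/-- `M_N(0) = M(N)`. [folklore] -/
lemma moebiusSum_zero_eq (N : ℕ) : moebiusSum N 0 = (mertensFunction (N : ℝ) : ℂ) := by
  rw [MertensDictionary.mertensFunction_natCast, moebiusSum]
  push_cast
  rw [show (Finset.Icc 1 N) = Finset.Ioc 0 N from Finset.Icc_add_one_left_eq_Ioc 0 N]
  refine Finset.sum_congr rfl fun a _ ↦ by simp

/-- `log(N + ½) ≤ 2√N` for `N ≥ 1`. [folklore] -/
lemma log_le_two_sqrt {N : ℕ} (hN : 1 ≤ N) : Real.log ((N : ℝ) + 1 / 2) ≤ 2 * Real.sqrt N := by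
  have hN1 : (1 : ℝ) ≤ N := by exact_mod_cast hN
  have hs0 : 0 ≤ Real.sqrt N := Real.sqrt_nonneg _
  -- `√(N + ½) ≤ √N + 1`
  have hx : Real.sqrt ((N : ℝ) + 1 / 2) ≤ Real.sqrt N + 1 := by
    have h1 : (N : ℝ) + 1 / 2 ≤ (Real.sqrt N + 1) ^ 2 := by
      rw [add_sq, Real.sq_sqrt (by linarith)]; nlinarith
    calc Real.sqrt ((N : ℝ) + 1 / 2) ≤ Real.sqrt ((Real.sqrt N + 1) ^ 2) := Real.sqrt_le_sqrt h1
      _ = Real.sqrt N + 1 := Real.sqrt_sq (by positivity)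
  have hx0 : 0 < Real.sqrt ((N : ℝ) + 1 / 2) := Real.sqrt_pos.2 (by linarith)
  have h2 : Real.log (Real.sqrt ((N : ℝ) + 1 / 2)) ≤ Real.sqrt ((N : ℝ) + 1 / 2) - 1 :=
    Real.log_le_sub_one_of_pos hx0
  have h3 : Real.log ((N : ℝ) + 1 / 2) = 2 * Real.log (Real.sqrt ((N : ℝ) + 1 / 2)) := by
    rw [Real.log_sqrt (by linarith)]; ring
  rw [h3]; linarith

/-! ### The bound at integers, for `N` large -/

/-- **`|M(N)| ≤ K √N exp(Λ(N))` for `N` large**, `Λ(N) = (log N)^{1/2}(log log N)^{5/2+6δ}`, from the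
engine at level `δ` (Balazard–de Roton 2008, §8.5 with `c = 5/2`). [cite: BalazardRoton2008, §8.5] -/
theorem exists_mertens_nat_le (hRH : RiemannHypothesis) {δ : ℝ} (hδ0 : 0 < δ) (hδ1 : δ ≤ 1)
    (h1 : ∃ D T₀ : ℝ, Prop1With δ D T₀) (h18 : ∃ T₀ : ℝ, Prop18With δ T₀)
    (h20 : ∃ C D T₀ : ℝ, Prop20With δ C D T₀) :
    ∃ (N₁ : ℕ) (K : ℝ), 0 < K ∧ ∀ N : ℕ, N₁ ≤ N →
      |(mertensFunction (N : ℝ) : ℝ)| ≤ K * Real.sqrt N * Real.exp (lam (5 / 2 + 6 * δ) N) := by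
  obtain ⟨D, T₁, hP1⟩ := h1
  obtain ⟨T₁₈, hP18⟩ := h18
  obtain ⟨C, D₂₀, T₂₀, hP20⟩ := h20
  have hP1' := Prop1With.mono_max hδ0 hP1
  have hP20' := Prop20With.mono_max hP20
  set D' := max D 0 with hD'
  set C' := max C 0 with hC'
  have hD0 : 0 ≤ D' := le_max_right _ _
  have hC0 : 0 ≤ C' := le_max_right _ _
  -- thresholds
  obtain ⟨t₁, ht₁⟩ := exists_goodSize T₁ T₁₈
  obtain ⟨t₂, ht₂⟩ := exists_goodCount δ D₂₀ (max T₂₀ 0)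
  obtain ⟨t₃, ht₃⟩ := exists_midGood T₁ T₁₈
  set tthr := max t₁ t₂ with htthr
  have hthr : ∀ t : ℝ, tthr ≤ t → GoodSize T₁ T₁₈ t ∧ GoodCount δ D₂₀ (max T₂₀ 0) t := fun t ht ↦
    ⟨ht₁ t (le_trans (le_max_left _ _) ht), ht₂ t (le_trans (le_max_right _ _) ht)⟩
  set t₀ := max 1 t₃ with ht₀
  obtain ⟨Ca, hCa, M, hsmall⟩ := InvZetaSmallRH.exists_norm_inv_zeta_le_rpow_neg hRH (le_max_left 1 t₃)
  have hmid : ∀ t : ℝ, t₀ < t → MidGood T₁ T₁₈ t := fun t ht ↦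
    ht₃ t (le_trans (le_max_right _ _) ht.le)
  obtain ⟨N₁, hN₁⟩ := eventually_largeN δ D' C' D₂₀ Ca M tthr hδ0
  obtain ⟨KP, hKP, hPerron⟩ := norm_moebiusSum_twist_sub_perron_le
  refine ⟨max N₁ 3, 17 + 2 * KP, by positivity, fun N hN ↦ ?_⟩
  have hN₁N : N₁ ≤ N := le_trans (le_max_left _ _) hN
  have hN3 : 3 ≤ N := le_trans (le_max_right _ _) hN
  have hL := hN₁ N hN₁N
  obtain ⟨hu22, hκ1, hκK, -, -, -, -, hTN, hNT, hN0⟩ := params hL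
  have hTx : ((bigT N : ℕ) : ℝ) ≤ (N : ℝ) + 1 / 2 := by
    have : ((bigT N : ℕ) : ℝ) ≤ N := by exact_mod_cast hTN
    linarith
  have hxT : ((N : ℝ) + 1 / 2) / 2 ≤ ((bigT N : ℕ) : ℝ) := by
    have : (N : ℝ) + 1 ≤ 2 * ((bigT N : ℕ) : ℝ) := by exact_mod_cast hNT
    linarith
  have hτ : |(0 : ℝ)| ≤ ((bigT N : ℕ) : ℝ) / 4 := by rw [abs_zero]; positivity
  -- Perron at `τ = 0` and the contour bound at `τ = 0`
  have hP := hPerron N hN3 ((N : ℝ) + 1 / 2) (1 + 1 / Real.log ((N : ℝ) + 1 / 2)) rfl rfl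
    ((bigT N : ℕ) : ℝ) hxT hTx 0 hτ
  have hB := perron_integral_le_of_largeN (τ := 0) hRH hδ0 hδ1 hD0 hP1' hP18 hL hthr hCa.le hsmall hmid
    (c := 1 + 1 / Real.log ((N : ℝ) + 1 / 2)) rfl hτ
  have hfar := far_sum_le hδ0 hδ1 hD0 hP18 hP20' hC0 hL hthr
  set B := ∫ u in (-((bigT N : ℕ) : ℝ))..((bigT N : ℕ) : ℝ),
    (riemannZeta ((1 + 1 / Real.log ((N : ℝ) + 1 / 2) : ℝ) + u * I))⁻¹ *
      ((((N : ℝ) + 1 / 2 : ℝ) : ℂ) ^ (((1 + 1 / Real.log ((N : ℝ) + 1 / 2) : ℝ) : ℂ) + u * I) /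
        (((1 + 1 / Real.log ((N : ℝ) + 1 / 2) : ℝ) : ℂ) + u * I - (0 : ℝ) * I)) with hBdef
  set Λ := lam (5 / 2 + 6 * δ) N with hΛdef
  -- `S(0) = 2 Σ e^{E_n}/(n+1) ≤ 2 e^{Λ}`
  have hS : ∑ n ∈ Finset.Ico (nzero N) (bigT N),
      Real.exp (blockE δ (max D' 0 + 2) (Real.log ((N : ℝ) + 1 / 2)) n) *
        (1 / (1 + |(n : ℝ) - 0|) + 1 / (1 + |(n : ℝ) + 0|)) ≤ 2 * Real.exp Λ := by
    have e : ∀ n : ℕ, Real.exp (blockE δ (max D' 0 + 2) (Real.log ((N : ℝ) + 1 / 2)) n) *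
        (1 / (1 + |(n : ℝ) - 0|) + 1 / (1 + |(n : ℝ) + 0|)) =
        2 * (Real.exp (blockE δ (max D' 0 + 2) (Real.log ((N : ℝ) + 1 / 2)) n) / ((n : ℝ) + 1)) := by
      intro n
      rw [sub_zero, add_zero, Nat.abs_cast]
      ring
    rw [Finset.sum_congr rfl (fun n _ ↦ e n), ← Finset.mul_sum]
    linarith
  -- sizes
  have hΛ1 : 1 ≤ Real.exp Λ := by
    apply Real.one_le_exp
    rw [hΛdef]; unfold lam
    exact mul_nonneg (Real.rpow_nonneg (by linarith) _) (Real.rpow_nonneg (Real.log_nonneg (by linarith)) _)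
  have hsx0 : 0 ≤ Real.sqrt ((N : ℝ) + 1 / 2) := Real.sqrt_nonneg _
  have hN1 : (1 : ℝ) ≤ N := by exact_mod_cast (show 1 ≤ N by omega)
  have hsx : Real.sqrt ((N : ℝ) + 1 / 2) ≤ 2 * Real.sqrt N := by
    calc Real.sqrt ((N : ℝ) + 1 / 2) ≤ Real.sqrt (4 * N) := Real.sqrt_le_sqrt (by linarith)
      _ = 2 * Real.sqrt N := by
          rw [Real.sqrt_mul (by norm_num), show (4 : ℝ) = 2 ^ 2 by norm_num, Real.sqrt_sq (by norm_num)]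
  have hlogx : Real.log ((N : ℝ) + 1 / 2) ≤ 2 * Real.sqrt N := log_le_two_sqrt (by omega)
  have hsN0 : 0 ≤ Real.sqrt (N : ℝ) := Real.sqrt_nonneg _
  -- `‖B‖ ≤ 49 √x e^Λ + √x ≤ 100 √N e^Λ`
  have hB' : ‖B‖ ≤ 100 * Real.sqrt N * Real.exp Λ := by
    have h1 : ‖B‖ ≤ Real.sqrt ((N : ℝ) + 1 / 2) * (49 * Real.exp Λ) + Real.sqrt ((N : ℝ) + 1 / 2) := by
      refine hB.trans ?_
      nlinarith [mul_le_mul_of_nonneg_left hS hsx0]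
    have h2 : Real.sqrt ((N : ℝ) + 1 / 2) * (49 * Real.exp Λ) ≤ 2 * Real.sqrt N * (49 * Real.exp Λ) :=
      mul_le_mul_of_nonneg_right hsx (by positivity)
    have h3 : Real.sqrt ((N : ℝ) + 1 / 2) ≤ 2 * Real.sqrt N * Real.exp Λ := by
      calc Real.sqrt ((N : ℝ) + 1 / 2) ≤ 2 * Real.sqrt N := hsx
        _ ≤ 2 * Real.sqrt N * Real.exp Λ := le_mul_of_one_le_right (by positivity) hΛ1
    linarith
  -- `‖(2π)⁻¹ x^0 B‖ ≤ ‖B‖/6`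
  have hnormB : ‖(2 * π : ℂ)⁻¹ * (((N : ℝ) + 1 / 2 : ℝ) : ℂ) ^ (-(((0 : ℝ) : ℂ) * I)) * B‖ ≤ ‖B‖ / 6 := by
    rw [norm_mul, norm_mul, show ((0 : ℝ) : ℂ) * I = 0 by simp, neg_zero, Complex.cpow_zero, norm_one,
      mul_one, norm_inv, Complex.norm_mul, Complex.norm_ofNat, Complex.norm_real, Real.norm_eq_abs,
      abs_of_pos Real.pi_pos, div_eq_inv_mul]
    refine mul_le_mul_of_nonneg_right ?_ (norm_nonneg _)
    exact inv_anti₀ (by norm_num) (by linarith [Real.pi_gt_three])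
  -- Perron: `‖M_N(0) − (2π)⁻¹ x^0 B‖ ≤ KP log x`
  have hP' : ‖moebiusSum N (((0 : ℝ) : ℂ) * I) -
      (2 * π : ℂ)⁻¹ * (((N : ℝ) + 1 / 2 : ℝ) : ℂ) ^ (-(((0 : ℝ) : ℂ) * I)) * B‖ ≤
      KP * Real.log ((N : ℝ) + 1 / 2) := by
    have := hP
    rw [abs_zero, add_zero, mul_one] at this
    exact this
  have htri := norm_le_insert' (moebiusSum N (((0 : ℝ) : ℂ) * I))
    ((2 * π : ℂ)⁻¹ * (((N : ℝ) + 1 / 2 : ℝ) : ℂ) ^ (-(((0 : ℝ) : ℂ) * I)) * B)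
  -- `|M(N)| = ‖M_N(0)‖`
  have hMnorm : |(mertensFunction (N : ℝ) : ℝ)| = ‖moebiusSum N (((0 : ℝ) : ℂ) * I)‖ := by
    rw [show ((0 : ℝ) : ℂ) * I = 0 by simp, moebiusSum_zero_eq, ← Complex.ofReal_intCast, Complex.norm_real,
      Real.norm_eq_abs]
  rw [hMnorm]
  have hKlog : KP * Real.log ((N : ℝ) + 1 / 2) ≤ 2 * KP * Real.sqrt N * Real.exp Λ := by
    calc KP * Real.log ((N : ℝ) + 1 / 2) ≤ KP * (2 * Real.sqrt N) := mul_le_mul_of_nonneg_left hlogx hKP.le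
      _ = 2 * KP * Real.sqrt N := by ring
      _ ≤ 2 * KP * Real.sqrt N * Real.exp Λ := le_mul_of_one_le_right (by positivity) hΛ1
  calc ‖moebiusSum N (((0 : ℝ) : ℂ) * I)‖
      ≤ ‖(2 * π : ℂ)⁻¹ * (((N : ℝ) + 1 / 2 : ℝ) : ℂ) ^ (-(((0 : ℝ) : ℂ) * I)) * B‖ +
          ‖moebiusSum N (((0 : ℝ) : ℂ) * I) -
            (2 * π : ℂ)⁻¹ * (((N : ℝ) + 1 / 2 : ℝ) : ℂ) ^ (-(((0 : ℝ) : ℂ) * I)) * B‖ := htri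
    _ ≤ ‖B‖ / 6 + KP * Real.log ((N : ℝ) + 1 / 2) := add_le_add hnormB hP'
    _ ≤ 100 * Real.sqrt N * Real.exp Λ / 6 + 2 * KP * Real.sqrt N * Real.exp Λ := by
        have := div_le_div_of_nonneg_right hB' (by norm_num : (0 : ℝ) ≤ 6)
        linarith
    _ ≤ (17 + 2 * KP) * Real.sqrt N * Real.exp Λ := by
        have : 0 ≤ Real.sqrt N * Real.exp Λ := by positivity
        nlinarith

/-! ### The bound for all real `x ≥ 3` -/

/-- **Soundararajan's theorem (Balazard–de Roton's form) from the engine.** Under RH and the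
conclusions of Balazard–de Roton 2008, Props. 1, 18, 20 at every level `δ ∈ (0,1]`:
for every `δ' ∈ (0, ½]` there is `C > 0` with `|M(x)| ≤ C √x exp((log x)^{1/2}(log log x)^{5/2+δ'})`
for all `x ≥ 3` — hypothesis `hA` of `BalazardDeRoton2010_thm1_of_deep`.
[cite: BalazardRoton2008, Théorème 1] -/
theorem mertens_bound_of_engine (hRH : RiemannHypothesis)
    (h1 : ∀ δ : ℝ, 0 < δ → δ ≤ 1 → ∃ D T₀ : ℝ, Prop1With δ D T₀)
    (h18 : ∀ δ : ℝ, 0 < δ → δ ≤ 1 → ∃ T₀ : ℝ, Prop18With δ T₀)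
    (h20 : ∀ δ : ℝ, 0 < δ → δ ≤ 1 → ∃ C D T₀ : ℝ, Prop20With δ C D T₀) :
    ∀ δ : ℝ, 0 < δ → δ ≤ 1 / 2 → ∃ C : ℝ, 0 < C ∧ ∀ x : ℝ, 3 ≤ x →
      |(mertensFunction x : ℝ)| ≤ C * Real.sqrt x * gFun (5 / 2 + δ) x := by
  intro δ' hδ'0 hδ'1
  set δ := δ' / 6 with hδ
  have hδ0 : 0 < δ := by positivity
  have hδ1 : δ ≤ 1 := by rw [hδ]; linarith
  obtain ⟨N₁, K, hK, hMN⟩ := exists_mertens_nat_le hRH hδ0 hδ1 (h1 δ hδ0 hδ1) (h18 δ hδ0 hδ1)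
    (h20 δ hδ0 hδ1)
  have hp : (5 / 2 + 6 * δ : ℝ) = 5 / 2 + δ' := by rw [hδ]; ring
  refine ⟨max K (max N₁ 16), lt_max_of_lt_left hK, fun x hx ↦ ?_⟩
  set N := ⌊x⌋₊ with hN
  have hx0 : 0 < x := by linarith
  have hNx : (N : ℝ) ≤ x := Nat.floor_le hx0.le
  have hxN : x < N + 1 := Nat.lt_floor_add_one x
  have hMx : mertensFunction x = mertensFunction (N : ℝ) := by
    simp [mertensFunction, hN]
  have hG1 : 1 ≤ gFun (5 / 2 + δ') x := by
    unfold gFun eExp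
    apply Real.one_le_exp
    have hlx : 1 ≤ Real.log x := by
      rw [← Real.log_exp 1]; refine Real.log_le_log (Real.exp_pos 1) ?_
      have := Real.exp_one_lt_d9; linarith
    exact mul_nonneg (Real.rpow_nonneg (by linarith) _) (Real.rpow_nonneg (Real.log_nonneg hlx) _)
  have hsx1 : 1 ≤ Real.sqrt x := by rw [← Real.sqrt_one]; exact Real.sqrt_le_sqrt (by linarith)
  rw [hMx]
  rcases le_or_gt (max N₁ 16) N with hbig | hsmall
  · -- large `N`: the engine bound, then monotonicity in `x`
    have hN₁ : N₁ ≤ N := le_trans (le_max_left _ _) hbig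
    have hN16 : 16 ≤ N := le_trans (le_max_right _ _) hbig
    have hN16' : (16 : ℝ) ≤ N := by exact_mod_cast hN16
    have h := hMN N hN₁
    have hlam : Real.exp (lam (5 / 2 + 6 * δ) N) = gFun (5 / 2 + δ') N := by
      rw [hp]; rfl
    rw [hlam] at h
    calc |(mertensFunction (N : ℝ) : ℝ)| ≤ K * Real.sqrt N * gFun (5 / 2 + δ') N := h
      _ ≤ K * Real.sqrt x * gFun (5 / 2 + δ') x := by
          refine mul_le_mul (mul_le_mul_of_nonneg_left (Real.sqrt_le_sqrt hNx) hK.le)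
            (gFun_mono (by linarith) hN16' hNx) (gFun_pos _ _).le (by positivity)
      _ ≤ max K (max N₁ 16) * Real.sqrt x * gFun (5 / 2 + δ') x :=
          mul_le_mul_of_nonneg_right (mul_le_mul_of_nonneg_right (le_max_left _ _)
            (Real.sqrt_nonneg _)) (gFun_pos _ _).le
  · -- small `N`: trivial bound
    have h1 : |(mertensFunction (N : ℝ) : ℝ)| ≤ N := MertensDictionary.abs_mertensFunction_natCast_le N
    have h2 : (N : ℝ) ≤ max K (max (N₁ : ℝ) 16) := by
      have : (N : ℝ) ≤ ((max N₁ 16 : ℕ) : ℝ) := by exact_mod_cast hsmall.le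
      push_cast at this
      exact this.trans (le_max_right _ _)
    have h3 : (max K (max N₁ 16) : ℝ) ≤ max K (max N₁ 16) * Real.sqrt x * gFun (5 / 2 + δ') x := by
      have h0 : 0 ≤ max K (max (N₁ : ℝ) 16) := le_trans hK.le (le_max_left _ _)
      calc (max K (max N₁ 16) : ℝ) = max K (max N₁ 16) * 1 * 1 := by ring
        _ ≤ max K (max N₁ 16) * Real.sqrt x * gFun (5 / 2 + δ') x :=
            mul_le_mul (mul_le_mul_of_nonneg_left hsx1 h0) hG1 zero_le_one (by positivity)
    linarith

end SoundContour

end Literature.NumberTheory.LFunctions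

end
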